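import Summits.KontsevichZagierPeriods.KontsevichZagierPeriods.Theorems.SymplecticScissorsRealOnePeriodRelationsStubEllPath
import Mathlib.Analysis.SpecialFunctions.Sqrt

/-!
# `RealOnePeriodRelations` (stmt-KontsevichZagierPeriods-10042), line `nash-retraction-thin-strip`,
# the loop layer: stub `stub_ovalPath` — THE OVAL LOOP

For real algebraic `A, B` with `4A³ + 27B² ≠ 0` and consecutive real roots `e₁ < e₂` of
`f = x³ + Ax + B` with `f > 0` on `(e₁, e₂)`, the real oval of the affine Weierstrass curve
`E_{A,B} : y² = f(x)` over `[e₁, e₂]` is a closed loop.  It is parametrised there and back by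
`x(t) = e₁ + 16 (e₂ − e₁) t² (1 − t)²` (`x(0) = x(1) = e₁`, `x(½) = e₂`, double zeros of `x − e₁` at
`t = 0, 1` and of `x − e₂` at `t = ½`) and `y = +√f(x(t))` on `[0, ½]`, `y = −√f(x(t))` on `[½, 1]`.

The algebra making this `C¹` (indeed smooth): from `f(e₁) = f(e₂) = 0`, `e₁ ≠ e₂` one gets Vieta
`A = −(e₁² + e₁e₂ + e₂²)`, `B = e₁e₂(e₁ + e₂)`, so `f = (x − e₁)(x − e₂)(x + e₁ + e₂)`, and
`f(x(t)) = p(t)² q(t)` with `p(t) = 4 (e₂ − e₁) t (1 − t)(1 − 2t)` and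
`q(t) = (4t(1 − t) + 1)(−e₁ − e₂ − x(t))`.  The third root `e₃ = −e₁ − e₂` satisfies `e₃ > e₂`
(`f′(e₂) = (e₂ − e₁)(e₂ − e₃) < 0` since `f > 0` to the left of the simple root `e₂`), so `q > 0` on
`[0, 1]` (where `x(t) ≤ e₂`), and `y(t) := p(t) √q(t)` is a smooth function with `y² = f ∘ x`,
`y = √(f ∘ x)` on `[0, ½]` (`p ≥ 0`) and `y = −√(f ∘ x)` on `[½, 1]` (`p ≤ 0`).  The path
`t ↦ (x(t), y(t))` is a `CurvePeriods.CurvePath` on `weierCurve A B` (Huber–Wüstholz 2022, §3.3.1)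
closed at the algebraic point `(e₁, 0)`, and its real and imaginary parts are `ℚ`-semialgebraic on
`[0, 1]` (Tarski–Seidenberg bookkeeping with the tree's `IsSemialgebraicFunOn` kit,
Bochnak–Coste–Roy 1998, §2.2).  Everything here is folklore calculus.
-/

noncomputable section

open scoped BigOperators Polynomial
open Set MeasureTheory MvPolynomial
open Literature.NumberTheory.Transcendental Literature.NumberTheory.Transcendental.CurvePeriods
open Literature.ModelTheory.ExponentialFields (IsSemialgebraic)

namespace Summit.KontsevichZagierPeriods.SymplecticScissors.RealOnePeriodRelations.LoopLayer

namespace OvalPath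

/-! ## Elementary algebra of the cubic with two real roots -/

/-- VIETA for two distinct roots `e₁ ≠ e₂` of `f = x³ + Ax + B`: `A = −(e₁² + e₁e₂ + e₂²)` and
`B = e₁e₂(e₁ + e₂)` (so the third root is `−e₁ − e₂`). [folklore] -/
theorem vieta_of_two_roots {A B e₁ e₂ : ℝ} (h12 : e₁ ≠ e₂) (he₁ : e₁ ^ 3 + A * e₁ + B = 0)
    (he₂ : e₂ ^ 3 + A * e₂ + B = 0) :
    A = -(e₁ ^ 2 + e₁ * e₂ + e₂ ^ 2) ∧ B = e₁ * e₂ * (e₁ + e₂) := by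
  have h : (e₂ - e₁) * (e₁ ^ 2 + e₁ * e₂ + e₂ ^ 2 + A) = 0 := by linear_combination he₂ - he₁
  have hA : A = -(e₁ ^ 2 + e₁ * e₂ + e₂ ^ 2) := by
    rcases mul_eq_zero.1 h with h | h
    · exact absurd (sub_eq_zero.1 h).symm h12
    · linarith
  refine ⟨hA, ?_⟩
  rw [hA] at he₁
  linear_combination he₁

/-- THE THIRD ROOT LIES TO THE RIGHT: if `e₁ < e₂` are roots of `f = x³ + Ax + B`, `4A³ + 27B² ≠ 0` and
`f > 0` on `(e₁, e₂)`, then `e₂ < −e₁ − e₂` (`f′(e₂) = 3e₂² + A = (e₂ − e₁)(2e₂ + e₁) < 0`).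
[folklore] -/
theorem lt_thirdRoot {A B e₁ e₂ : ℝ} (h12 : e₁ < e₂) (hD : 4 * A ^ 3 + 27 * B ^ 2 ≠ 0)
    (he₁ : e₁ ^ 3 + A * e₁ + B = 0) (he₂ : e₂ ^ 3 + A * e₂ + B = 0)
    (hpos : ∀ x ∈ Ioo e₁ e₂, 0 < x ^ 3 + A * x + B) : e₂ < -e₁ - e₂ := by
  have hd : 3 * e₂ ^ 2 + A < 0 := EllipticLayer.deriv_neg_of_root_right h12 hD hpos he₂
  have hA := (vieta_of_two_roots h12.ne he₁ he₂).1
  have hid : (e₂ - e₁) * (2 * e₂ + e₁) = 3 * e₂ ^ 2 + A := by rw [hA]; ring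
  by_contra hc
  have hc' : 0 ≤ (e₂ - e₁) * (2 * e₂ + e₁) :=
    mul_nonneg (sub_pos.2 h12).le (by linarith [not_lt.1 hc])
  linarith

/-- `16 t² (1 − t)² ≤ 1` on `[0, 1]`: `1 − 16t²(1 − t)² = (1 − 2t)² (1 + 4t(1 − t))`. [folklore] -/
theorem quartic_le_one {t : ℝ} (ht : t ∈ Icc (0 : ℝ) 1) : 16 * t ^ 2 * (1 - t) ^ 2 ≤ 1 := by
  have hu : 0 ≤ t * (1 - t) := mul_nonneg ht.1 (sub_nonneg.2 ht.2)
  have h : 0 ≤ (1 - 2 * t) ^ 2 * (1 + 4 * (t * (1 - t))) := mul_nonneg (sq_nonneg _) (by linarith)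
  nlinarith [h]

/-! ## The oval loop -/

/-- THE OVAL LOOP, abstract form: for `f = x³ + Ax + B` and `x(t) = e₁ + 16(e₂ − e₁)t²(1 − t)²` as
functions (`e₁ < e₂` consecutive algebraic roots, `f > 0` in between, `4A³ + 27B² ≠ 0`), there is a
`C¹` path on `E_{A,B}`, closed at `(e₁, 0)`, equal to `(x(t), √f(x(t)))` on `[0, ½]` and to
`(x(t), −√f(x(t)))` on `[½, 1]`, with `ℚ`-semialgebraic real and imaginary parts on `[0, 1]`: its second
coordinate is the smooth function `4(e₂ − e₁) t(1 − t)(1 − 2t) √q(t)`,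
`q(t) = (4t(1 − t) + 1)(−e₁ − e₂ − x(t)) > 0`. [folklore] -/
theorem exists_path {A B e₁ e₂ : ℝ} {f xt : ℝ → ℝ} (hf : ∀ x, f x = x ^ 3 + A * x + B)
    (hxt : ∀ t, xt t = e₁ + (e₂ - e₁) * (16 * t ^ 2 * (1 - t) ^ 2))
    (h₁ : IsAlgebraic ℚ e₁) (h₂ : IsAlgebraic ℚ e₂) (h12 : e₁ < e₂) (hD : 4 * A ^ 3 + 27 * B ^ 2 ≠ 0)
    (he₁ : f e₁ = 0) (he₂ : f e₂ = 0) (hpos : ∀ x ∈ Ioo e₁ e₂, 0 < f x) :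
    ∃ γ : CurvePath (weierCurve (A : ℂ) (B : ℂ)), γ.toFun 1 = γ.toFun 0 ∧
      (∀ t ∈ Icc (0 : ℝ) (1 / 2), γ.toFun t =
        ![((xt t : ℝ) : ℂ), ((Real.sqrt (f (xt t)) : ℝ) : ℂ)]) ∧
      (∀ t ∈ Icc (1 / 2 : ℝ) 1, γ.toFun t =
        ![((xt t : ℝ) : ℂ), ((-Real.sqrt (f (xt t)) : ℝ) : ℂ)]) ∧
      IsSemialgebraicMapOn ℚ {z : Fin 1 → ℝ | z 0 ∈ Icc (0 : ℝ) 1}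
        (fun z => Fin.append (fun i => (γ.toFun (z 0) i).re) (fun i => (γ.toFun (z 0) i).im)) := by
  have hxe : xt = fun t => e₁ + (e₂ - e₁) * (16 * t ^ 2 * (1 - t) ^ 2) := funext hxt
  have he₁' : e₁ ^ 3 + A * e₁ + B = 0 := by rw [← hf]; exact he₁
  have he₂' : e₂ ^ 3 + A * e₂ + B = 0 := by rw [← hf]; exact he₂
  have hpos' : ∀ x ∈ Ioo e₁ e₂, 0 < x ^ 3 + A * x + B := fun x hx => by
    simpa only [hf] using hpos x hx
  obtain ⟨hA', hB'⟩ := vieta_of_two_roots h12.ne he₁' he₂'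
  have h3 : e₂ < -e₁ - e₂ := lt_thirdRoot h12 hD he₁' he₂' hpos'
  -- the auxiliary functions `p(t) = 4(e₂ − e₁) t(1 − t)(1 − 2t)`, `q`, and `y = p √q`
  obtain ⟨p, hp⟩ : ∃ p : ℝ → ℝ, ∀ t, p t = 4 * (e₂ - e₁) * (t * (1 - t) * (1 - 2 * t)) :=
    ⟨_, fun _ => rfl⟩
  obtain ⟨q, hq⟩ : ∃ q : ℝ → ℝ, ∀ t, q t = (4 * (t * (1 - t)) + 1) * (-e₁ - e₂ - xt t) :=
    ⟨_, fun _ => rfl⟩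
  obtain ⟨yt, hyt⟩ : ∃ yt : ℝ → ℝ, ∀ t, yt t = p t * Real.sqrt (q t) := ⟨_, fun _ => rfl⟩
  have hpe : p = fun t => 4 * (e₂ - e₁) * (t * (1 - t) * (1 - 2 * t)) := funext hp
  have hqe : q = fun t => (4 * (t * (1 - t)) + 1) * (-e₁ - e₂ - xt t) := funext hq
  have hye : yt = fun t => p t * Real.sqrt (q t) := funext hyt
  -- KEY IDENTITY `f(x(t)) = p(t)² q(t)`
  have hkey : ∀ t, f (xt t) = p t ^ 2 * q t := fun t => by
    rw [hf, hp, hq, hxt, hA', hB']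
    ring
  -- `q > 0` on `[0, 1]` (there `x(t) ≤ e₂ < −e₁ − e₂`)
  have hq_pos : ∀ t ∈ Icc (0 : ℝ) 1, 0 < q t := fun t ht => by
    have hu : 0 ≤ t * (1 - t) := mul_nonneg ht.1 (sub_nonneg.2 ht.2)
    have hle : xt t ≤ e₂ := by
      have := mul_le_mul_of_nonneg_left (quartic_le_one ht) (sub_pos.2 h12).le
      rw [hxt]
      linarith
    rw [hq]
    exact mul_pos (by linarith) (by linarith)
  -- `y = √(f ∘ x)` on `[0, ½]` and `y = −√(f ∘ x)` on `[½, 1]`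
  have hy1 : ∀ t ∈ Icc (0 : ℝ) (1 / 2), yt t = Real.sqrt (f (xt t)) := fun t ht => by
    have hpt : 0 ≤ p t := by
      rw [hp]
      exact mul_nonneg (mul_nonneg (by norm_num) (sub_pos.2 h12).le)
        (mul_nonneg (mul_nonneg ht.1 (by linarith [ht.2])) (by linarith [ht.2]))
    rw [hkey, Real.sqrt_mul (sq_nonneg _), Real.sqrt_sq hpt, hyt]
  have hy2 : ∀ t ∈ Icc (1 / 2 : ℝ) 1, yt t = -Real.sqrt (f (xt t)) := fun t ht => by
    have hpt : p t ≤ 0 := by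
      rw [hp]
      exact mul_nonpos_of_nonneg_of_nonpos (mul_nonneg (by norm_num) (sub_pos.2 h12).le)
        (mul_nonpos_of_nonneg_of_nonpos (mul_nonneg (by linarith [ht.1]) (sub_nonneg.2 ht.2))
          (by linarith [ht.1]))
    rw [hkey, Real.sqrt_mul (sq_nonneg _), Real.sqrt_sq_eq_abs, abs_of_nonpos hpt, hyt]
    ring
  -- values at the end points
  have hx0 : xt 0 = e₁ := by rw [hxt]; ring
  have hx1 : xt 1 = e₁ := by rw [hxt]; ring
  have hy0 : yt 0 = 0 := by rw [hyt, hp]; ring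
  have hy1' : yt 1 = 0 := by rw [hyt, hp]; ring
  -- regularity: `x, p, q` polynomial, `y = p √q` smooth near every point of `[0, 1]` (`q > 0` there)
  have hx_cd : ContDiff ℝ 1 xt := by rw [hxe]; fun_prop
  have hp_cd : ContDiff ℝ 1 p := by rw [hpe]; fun_prop
  have hq_cd : ContDiff ℝ 1 q := by rw [hqe, hxe]; fun_prop
  have hy_cd : ContDiffOn ℝ 1 yt (Icc 0 1) := fun t₀ ht₀ => by
    rw [hye]
    exact (hp_cd.contDiffAt.mul (hq_cd.contDiffAt.sqrt (hq_pos t₀ ht₀).ne')).contDiffWithinAt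
  -- on the curve: `y² = f(x)` on `[0, 1]`
  have hcurve : ∀ t ∈ Icc (0 : ℝ) 1, yt t ^ 2 = f (xt t) := fun t ht => by
    rw [hkey, hyt, mul_pow, Real.sq_sqrt (hq_pos t ht).le]
  let γ : CurvePath (weierCurve (A : ℂ) (B : ℂ)) :=
    { toFun := fun t => ![((xt t : ℝ) : ℂ), ((yt t : ℝ) : ℂ)]
      contDiffOn := by
        refine contDiffOn_pi.2 fun i => ?_
        fin_cases i
        · exact Complex.ofRealCLM.contDiff.comp_contDiffOn hx_cd.contDiffOn
        · exact Complex.ofRealCLM.contDiff.comp_contDiffOn hy_cd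
      mem_points := fun t ht => by
        rw [Weier.mem_points_iff, Weier.eval_fPoly]
        simp only [Matrix.cons_val_one, Matrix.cons_val_zero]
        have h := hcurve t ht
        rw [hf] at h
        exact_mod_cast h
      algebraic_zero := fun i => by
        fin_cases i
        · show IsAlgebraic ℚ ((xt 0 : ℝ) : ℂ)
          rw [hx0]
          exact h₁.algebraMap
        · show IsAlgebraic ℚ ((yt 0 : ℝ) : ℂ)
          rw [hy0, Complex.ofReal_zero]
          exact isAlgebraic_zero
      algebraic_one := fun i => by
        fin_cases i
        · show IsAlgebraic ℚ ((xt 1 : ℝ) : ℂ)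
          rw [hx1]
          exact h₁.algebraMap
        · show IsAlgebraic ℚ ((yt 1 : ℝ) : ℂ)
          rw [hy1', Complex.ofReal_zero]
          exact isAlgebraic_zero }
  have hγ : γ.toFun = fun t : ℝ => (![((xt t : ℝ) : ℂ), ((yt t : ℝ) : ℂ)] : Fin 2 → ℂ) := rfl
  refine ⟨γ, ?_, fun t ht => ?_, fun t ht => ?_, ?_⟩
  · -- closed: both ends are `(e₁, 0)`
    show (![((xt 1 : ℝ) : ℂ), ((yt 1 : ℝ) : ℂ)] : Fin 2 → ℂ) = ![((xt 0 : ℝ) : ℂ), ((yt 0 : ℝ) : ℂ)]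
    rw [hx0, hx1, hy0, hy1']
  · show (![((xt t : ℝ) : ℂ), ((yt t : ℝ) : ℂ)] : Fin 2 → ℂ) = _
    rw [hy1 t ht]
  · show (![((xt t : ℝ) : ℂ), ((yt t : ℝ) : ℂ)] : Fin 2 → ℂ) = _
    rw [hy2 t ht]
  -- the realified path is `ℚ`-semialgebraic on `[0, 1]`
  have hdom : IsSemialgebraic ℚ {z : Fin 1 → ℝ | z 0 ∈ Icc (0 : ℝ) 1} := Realises.isSemialgebraic_IccDom
  have hz : IsSemialgebraicFunOn ℚ {z : Fin 1 → ℝ | z 0 ∈ Icc (0 : ℝ) 1} (fun z => z 0) :=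
    (isSemialgebraicFunOn_aeval hdom (X 0)).congr fun z _ => by simp
  have hn : ∀ n : ℕ, IsSemialgebraicFunOn ℚ {z : Fin 1 → ℝ | z 0 ∈ Icc (0 : ℝ) 1} (fun _ => (n : ℝ)) :=
    fun n => isSemialgebraicFunOn_const_natCast hdom n
  have hX : IsSemialgebraicFunOn ℚ {z : Fin 1 → ℝ | z 0 ∈ Icc (0 : ℝ) 1} (fun z => xt (z 0)) :=
    ((isSemialgebraicFunOn_const_of_isAlgebraic hdom h₁).fun_add
      ((isSemialgebraicFunOn_const_of_isAlgebraic hdom (h₂.sub h₁)).fun_mul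
        ((((hn 16).fun_mul (hz.fun_pow 2)).fun_mul (((hn 1).fun_sub hz).fun_pow 2))))).congr
      fun z _ => by rw [hxt]; push_cast; ring
  have hP : IsSemialgebraicFunOn ℚ {z : Fin 1 → ℝ | z 0 ∈ Icc (0 : ℝ) 1} (fun z => p (z 0)) :=
    (((hn 4).fun_mul (isSemialgebraicFunOn_const_of_isAlgebraic hdom (h₂.sub h₁))).fun_mul
      ((hz.fun_mul ((hn 1).fun_sub hz)).fun_mul ((hn 1).fun_sub ((hn 2).fun_mul hz)))).congr
      fun z _ => by rw [hp]; push_cast; ring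
  have hQ : IsSemialgebraicFunOn ℚ {z : Fin 1 → ℝ | z 0 ∈ Icc (0 : ℝ) 1} (fun z => q (z 0)) :=
    ((((hn 4).fun_mul (hz.fun_mul ((hn 1).fun_sub hz))).fun_add (hn 1)).fun_mul
      ((((isSemialgebraicFunOn_const_of_isAlgebraic hdom h₁).fun_neg.fun_sub
        (isSemialgebraicFunOn_const_of_isAlgebraic hdom h₂)).fun_sub hX))).congr
      fun z _ => by rw [hq]; push_cast; ring
  have hY : IsSemialgebraicFunOn ℚ {z : Fin 1 → ℝ | z 0 ∈ Icc (0 : ℝ) 1} (fun z => yt (z 0)) :=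
    (hP.fun_mul hQ.fun_sqrt).congr fun z _ => (hyt _).symm
  show IsSemialgebraicMapOn ℚ {z : Fin 1 → ℝ | z 0 ∈ Icc (0 : ℝ) 1}
    (fun z => Fin.append (m := 2) (n := 2) (fun i => (γ.toFun (z 0) i).re)
      (fun i => (γ.toFun (z 0) i).im))
  refine IsSemialgebraicMapOn.of_forall hdom fun j => ?_
  refine Fin.addCases (fun i => ?_) (fun i => ?_) j
  · simp only [Fin.append_left, hγ]
    fin_cases i
    · exact hX.congr fun z _ => by simp
    · exact hY.congr fun z _ => by simp
  · simp only [Fin.append_right, hγ]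
    fin_cases i <;> exact (isSemialgebraicFunOn_natCast hdom 0).congr fun z _ => by simp

end OvalPath

/-- STUB `stub_ovalPath` — THE OVAL LOOP.  For real algebraic `A, B` with `4A³ + 27B² ≠ 0` and consecutive real roots
`e₁ < e₂` of `f = x³ + Ax + B` with `f > 0` on `(e₁, e₂)`, the closed path `t ↦ (x(t), ±√f(x(t)))`,
`x(t) = e₁ + 16(e₂ − e₁)t²(1 − t)²` (`+` on `[0, ½]`, `−` on `[½, 1]`), is a `C¹` loop on `E_{A,B}` at `(e₁, 0)` with
`ℚ`-semialgebraic real and imaginary parts: `f(x(t)) = 16(e₂ − e₁)² t²(1 − t)²(1 − 2t)² q(t)` with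
`q(t) = (4t(1 − t) + 1)(−e₁ − e₂ − x(t)) > 0` on `[0,1]`, so `±√f(x(t)) = 4(e₂ − e₁) t(1 − t)(1 − 2t)√q(t)` is smooth. [folklore] -/
theorem stub_ovalPath : ∀ (A B e₁ e₂ : ℝ), IsAlgebraic ℚ A → IsAlgebraic ℚ B → IsAlgebraic ℚ e₁ → IsAlgebraic ℚ e₂ →
    e₁ < e₂ → 4 * A ^ 3 + 27 * B ^ 2 ≠ 0 → e₁ ^ 3 + A * e₁ + B = 0 → e₂ ^ 3 + A * e₂ + B = 0 →
    (∀ x ∈ Set.Ioo e₁ e₂, 0 < x ^ 3 + A * x + B) →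
    ∃ γ : CurvePath (weierCurve (A : ℂ) (B : ℂ)), γ.toFun 1 = γ.toFun 0 ∧
      (∀ t ∈ Set.Icc (0 : ℝ) (1 / 2), γ.toFun t =
        ![(((e₁ + (e₂ - e₁) * (16 * t ^ 2 * (1 - t) ^ 2) : ℝ)) : ℂ),
          ((Real.sqrt ((e₁ + (e₂ - e₁) * (16 * t ^ 2 * (1 - t) ^ 2)) ^ 3 + A * (e₁ + (e₂ - e₁) * (16 * t ^ 2 * (1 - t) ^ 2)) + B) : ℝ) : ℂ)]) ∧
      (∀ t ∈ Set.Icc (1 / 2 : ℝ) 1, γ.toFun t =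
        ![(((e₁ + (e₂ - e₁) * (16 * t ^ 2 * (1 - t) ^ 2) : ℝ)) : ℂ),
          ((-Real.sqrt ((e₁ + (e₂ - e₁) * (16 * t ^ 2 * (1 - t) ^ 2)) ^ 3 + A * (e₁ + (e₂ - e₁) * (16 * t ^ 2 * (1 - t) ^ 2)) + B) : ℝ) : ℂ)]) ∧
      IsSemialgebraicMapOn ℚ {z : Fin 1 → ℝ | z 0 ∈ Set.Icc (0 : ℝ) 1}
        (fun z => Fin.append (fun i => (γ.toFun (z 0) i).re) (fun i => (γ.toFun (z 0) i).im)) := by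
  intro A B e₁ e₂ _ _ h₁ h₂ h12 hD he₁ he₂ hpos
  exact OvalPath.exists_path (f := fun x => x ^ 3 + A * x + B)
    (xt := fun t => e₁ + (e₂ - e₁) * (16 * t ^ 2 * (1 - t) ^ 2)) (fun _ => rfl) (fun _ => rfl)
    h₁ h₂ h12 hD he₁ he₂ hpos

end Summit.KontsevichZagierPeriods.SymplecticScissors.RealOnePeriodRelations.LoopLayer

end
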